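import Summits.BirchSwinnertonDyer.Rank1Residual.X1.ClassClosureN1
import Summits.BirchSwinnertonDyer.BirchSwinnertonDyer.Theorems.Rank1ResidualX1Defs
import Literature.NumberTheory.EllipticCurves.BertrandCMHeightNonvanishingOddPrime
import HarnessLib
import HarnessLib.Audit.Tags

/-!
# The rung leaf `TypeBRankOneUnridered` and its one typed crux `DegenerateLocusA2`
(cell `bsd-schneider-ideate`, seat P3 «weaken»; HUMAN RULINGS D-0059 / D-0061, 2026-08-25)

PROPOSED TREE FILE `Summits/BirchSwinnertonDyer/BirchSwinnertonDyer/Theorems/SchneiderWeakenLeaf.lean`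
(the SLIM landing unit: two closed `@[conjecture]` statements + five lines of proved logic; NOTHING
ABOUT ANY CURVE IS ASSERTED). Source memo: `pub/bsd-schneider-ideate/memos/ROUTE-P3.md` v4 (referee
PASS g7) §5.1 (M1); the β-road interface and the halting ball test stay in
`memos/ROUTE-P3-Sketch.lean` v4 / `memos/route-P3-D0059/SchneiderWeakenSockets.lean` (not landed).

Corner A2 = `X1.TypeBRankOne W p` (Eisenstein ANOMALOUS good prime `p > 2`, `E[p]` reducible of
Greenberg–Vatsal parity type B, `ord_{s=1} L(E,s) = 1`; 1 307 census cells, 2 797 class-pairs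
`N < 5·10⁵`). The kernel closes it MODULO the pair's Schneider certificate
(`X1.bsdp_of_typeBRankOne_of_schneider`, binder `hSch : ∀ Dh, Dh.IsCanonical → SchneiderConjecture Dh`).

* `TypeBRankOneUnridered` — the RUNG LEAF (D-0061 `--closes-target`): `BSD(E,p)` on A2 with NO
  Schneider binder. CLOSED `Prop`, `@[conjecture]`, nothing asserted.
* `DegenerateLocusA2` — the route's ONE typed crux: `BSD(E,p)` on the pairs of A2 at which THE
  canonical cyclotomic height is degenerate (`∃ Dh canonical, ¬ SchneiderConjecture Dh` — conjecturally
  never, Schneider 1982/85). Intended proof = the CRITICAL-SLOPE (β-)ROAD: on that locus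
  `h_β(P₀) = −c·log_ω(P₀)² ≠ 0` for free (Perrin-Riou 1993 3.3.7 Rem. ii), then Perrin-Riou's
  `D_[0]`-leading-term formula and the β-`p`-adic Gross–Zagier bridge (Büyükboduk–Pollack–Sasaki
  2018 Cor. 1.1.2, there only for `ρ̄` absolutely irreducible and conditional on Kobayashi).
* PROVED: `leaf_of_rider` (kernel theorem re-keyed), `leaf_of_degenerateLocus` (= the route's
  deciding theorem, by cases on the rider), `degenerateLocus_of_leaf`, the HONESTY LEMMA
  `leaf_iff_degenerateLocus_of_inputs` (modulo the six published inputs the crux is EQUIVALENT to the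
  leaf: a redirect onto the locus where only the β-road can act, declared as a conditional bridge —
  not a weakening), `leaf_of_bsdpOnClassX1` (leaf ⊂ the tree's `BSDpOnClassX1`),
  `not_degenerate_of_hasCM` (Bertrand: CM pairs are never degenerate — NOT a witness of weakness).
-/

set_option autoImplicit false

noncomputable section

open scoped Classical

open WeierstrassCurve Literature.NumberTheory.EllipticCurves
  Literature.NumberTheory.EllipticCurves.ModularForms
  Literature.NumberTheory.EllipticCurves.Rank1Residual
  Literature.NumberTheory.EllipticCurves.Rank1Residual.Typed
  Literature.Barriers.BirchSwinnertonDyer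
  Summit.BirchSwinnertonDyer.Rank1Residual
  Summit.BirchSwinnertonDyer.BirchSwinnertonDyer.Theorems

set_option linter.dupNamespace false

namespace Summit.BirchSwinnertonDyer.BirchSwinnertonDyer.Theorems.SchneiderWeaken

/-- **RUNG LEAF `TypeBRankOneUnridered` (D-0059 / D-0061; seat P3 «weaken»).** Corner A2 WITHOUT the
Schneider rider: for every globally minimal elliptic `E/ℚ` and prime `p` with `X1.TypeBRankOne E p`
(`p > 2` good, Eisenstein, anomalous, Greenberg–Vatsal parity type B, `ord_{s=1} L(E,s) = 1`; 1 307
cells, `p = 3` included), Miller's `BSD(E,p)`. The kernel proves it from six published facts GRANTED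
the pair's Schneider certificate (`X1.bsdp_of_typeBRankOne_of_schneider`); here no certificate.
CLOSED (no section variables); OPEN; nothing asserted. A slice of the tree's `BSDpOnClassX1`
(`leaf_of_bsdpOnClassX1`). [cite: Miller2011LMS, Def. 1.1] [cite: GreenbergVatsal2000, Thm. (1.3)] -/
@[conjecture]
def TypeBRankOneUnridered : Prop :=
  ∀ (W : WeierstrassCurve ℚ) [W.IsElliptic] [W.IsGloballyMinimal] (p : ℕ) [Fact p.Prime],
    X1.TypeBRankOne W p → BSDp W p

/-- **THE ROUTE'S TYPED CRUX `DegenerateLocusA2`.** `BSD(E,p)` at every pair of corner A2 at which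
THE canonical cyclotomic `p`-adic height (Mazur–Tate `σ`, pinned by `PAdicHeightData.IsCanonical`) is
DEGENERATE (`Reg_p = 0`; in rank one the generator is isotropic) — exactly the pairs where the
kernel's cyclotomic road (`[T¹]L_p(E,α,T) ∼ #Ш·Tam·h_α(P₀)/#tors²`, Perrin-Riou 1987) reads `0 = 0`.
Intended proof = the CRITICAL-SLOPE ROAD: `h_α(P₀) = 0 ⇒ h_β(P₀) = −c·log_ω(P₀)² ≠ 0` (Perrin-Riou
1993 3.3.7 Rem. ii / BPS 2018 §6.2; `c ≠ 0` and the identity confirmed on all 2 797 A2 class-pairs,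
kit j244598), then Perrin-Riou 1993 Prop. 3.4.6 in direction `D_[0]` and the β-`p`-adic Gross–Zagier
bridge (BPS Cor. 1.1.2, conditional on Kobayashi; in print only for `ρ̄` absolutely irreducible).
HONEST LABEL: modulo the published inputs this statement is EQUIVALENT to the leaf
(`leaf_iff_degenerateLocus_of_inputs`) — a redirect onto the locus where only the β-road can act, not
a weakening; conjecturally VACUOUS (Schneider). CLOSED; OPEN; nothing asserted.
[cite: PerrinRiou1993AIF, Prop. 3.4.6, 3.3.7 Rem. ii] [cite: BuyukbodukPollackSasaki2018, Cor. 1.1.2, Thm. 1.1.6]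
[cite: Schneider1985, §2] -/
@[conjecture]
def DegenerateLocusA2 : Prop :=
  ∀ (W : WeierstrassCurve ℚ) [W.IsElliptic] [W.IsGloballyMinimal] (p : ℕ) [Fact p.Prime],
    X1.TypeBRankOne W p →
      (∃ Dh : PAdicHeightData W p, Dh.IsCanonical ∧ ¬ SchneiderConjecture Dh) → BSDp W p

/-! ## The deciding logic (proved)

The six PUBLISHED inputs of the kernel's A2 theorem enter as hypotheses BY NAME: Greenberg–Vatsal
2000 Thm. (1.3) (`GreenbergVatsal2000.thm13_charIdeal_eq_of_gvPar`), Schneider 1985 /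
Balakrishnan–Müller–Stein 2015 Thm. 1.7 (`Schneider1985_order_charGenerator_odd`), Perrin-Riou 1987
§1.4 (`perrinRiou_rankOne_leadingTerms_odd`), the Mazur–Tate `σ` at odd `p`
(`mazur_tate_sigma_exists_odd`), modularity (`nonempty_modularParametrizationData`), GZK
(`rank_eq_analyticRank_of_analyticRank_le_one`). -/

/-- **Rider ⇒ leaf (the kernel theorem re-keyed).** Granted the six published inputs, Schneider's
non-degeneracy of THE canonical height at every A2 pair gives the leaf —
`X1.bsdp_of_typeBRankOne_of_schneider` verbatim. [cite: GreenbergVatsal2000, Thm. (1.3)] -/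
theorem leaf_of_rider (hGV : GreenbergVatsal2000.thm13_charIdeal_eq_of_gvPar)
    (hS : Schneider1985_order_charGenerator_odd) (hPR : perrinRiou_rankOne_leadingTerms_odd)
    (hMT : mazur_tate_sigma_exists_odd) (hmod : nonempty_modularParametrizationData)
    (hGZK : rank_eq_analyticRank_of_analyticRank_le_one)
    (hSch : ∀ (W : WeierstrassCurve ℚ) [W.IsElliptic] [W.IsGloballyMinimal] (p : ℕ) [Fact p.Prime],
      X1.TypeBRankOne W p → ∀ Dh : PAdicHeightData W p, Dh.IsCanonical → SchneiderConjecture Dh) :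
    TypeBRankOneUnridered :=
  fun W _ _ p _ hB ↦ X1.bsdp_of_typeBRankOne_of_schneider hGV hS hPR hMT hmod hGZK W p hB (hSch W p hB)

/-- **THE DECIDING THEOREM of route `SlopeDichotomyA2` (= its `closes`, proved): crux + published
inputs ⇒ leaf.** By cases on the rider at the pair: if every canonical datum satisfies Schneider, the
kernel's cyclotomic road (`X1.bsdp_of_typeBRankOne_of_schneider`); otherwise the pair is degenerate
and the crux applies. The dichotomy is used AS a disjunction: nothing here upgrades `h_α ∨ h_β` to
`h_α`. [cite: PerrinRiou1993AIF, 3.3.7 Rem. ii–iii] -/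
theorem leaf_of_degenerateLocus (h2 : DegenerateLocusA2)
    (hGV : GreenbergVatsal2000.thm13_charIdeal_eq_of_gvPar)
    (hS : Schneider1985_order_charGenerator_odd) (hPR : perrinRiou_rankOne_leadingTerms_odd)
    (hMT : mazur_tate_sigma_exists_odd) (hmod : nonempty_modularParametrizationData)
    (hGZK : rank_eq_analyticRank_of_analyticRank_le_one) :
    TypeBRankOneUnridered := by
  intro W _ _ p _ hB
  by_cases hSch : ∀ Dh : PAdicHeightData W p, Dh.IsCanonical → SchneiderConjecture Dh
  · exact X1.bsdp_of_typeBRankOne_of_schneider hGV hS hPR hMT hmod hGZK W p hB hSch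
  · push Not at hSch
    obtain ⟨Dh, hDh, hnot⟩ := hSch
    exact h2 W p hB ⟨Dh, hDh, hnot⟩

/-- Leaf ⇒ crux (trivial: drop the degeneracy hypothesis). [folklore] -/
theorem degenerateLocus_of_leaf (h : TypeBRankOneUnridered) : DegenerateLocusA2 :=
  fun W _ _ p _ hB _ ↦ h W p hB

/-- **HONESTY LEMMA.** Modulo the six published inputs the crux is EQUIVALENT to the leaf: it is the
leaf's whole open content, moved onto the locus where the cyclotomic road is void. (Hence the route
is declared a CONDITIONAL BRIDGE / redirect, D-0019 crux floor, and not a weakening.) [folklore] -/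
theorem leaf_iff_degenerateLocus_of_inputs (hGV : GreenbergVatsal2000.thm13_charIdeal_eq_of_gvPar)
    (hS : Schneider1985_order_charGenerator_odd) (hPR : perrinRiou_rankOne_leadingTerms_odd)
    (hMT : mazur_tate_sigma_exists_odd) (hmod : nonempty_modularParametrizationData)
    (hGZK : rank_eq_analyticRank_of_analyticRank_le_one) :
    TypeBRankOneUnridered ↔ DegenerateLocusA2 :=
  ⟨degenerateLocus_of_leaf, fun h ↦ leaf_of_degenerateLocus h hGV hS hPR hMT hmod hGZK⟩

/-- Reading: the leaf is a slice of the tree's conjecture-shaped `BSDpOnClassX1` (Keller–Yin's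
announced display, `Rank1ResidualX1Defs`). [folklore] -/
theorem leaf_of_bsdpOnClassX1 (h : Rank1ResidualX1Defs.BSDpOnClassX1) : TypeBRankOneUnridered :=
  fun W _ _ p _ hB ↦ h W p hB.1 (le_of_eq hB.2.1)

/-- Reading (Bertrand): at a CM curve of Mordell–Weil rank one and an odd good ordinary `p` NO
canonical datum is degenerate, so the crux holds vacuously on CM pairs. NOT a witness of weakness
(CM rank one lies inside the known regime); recorded so that no one mistakes it for one.
[cite: Bertrand1984ThetaCM, §3 Corollaire 1 (p. 21)] -/
theorem not_degenerate_of_hasCM (h : bertrand_pairing_self_ne_zero_of_hasCM_odd)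
    (W : WeierstrassCurve ℚ) [W.IsElliptic] [W.IsGloballyMinimal] (hCM : W.HasCM) (p : ℕ)
    [Fact p.Prime] (hp2 : p ≠ 2) (hgood : W.HasGoodReductionAtPrime p)
    (hord : ¬ (p : ℤ) ∣ W.frobeniusTrace p) (hrank : W.mordellWeilRank = 1) :
    ¬ ∃ Dh : PAdicHeightData W p, Dh.IsCanonical ∧ ¬ SchneiderConjecture Dh := by
  rintro ⟨Dh, hDh, hnot⟩
  exact hnot (schneiderConjecture_of_hasCM_of_rank_one_odd h W hCM p hp2 hgood hord hrank Dh hDh)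

end Summit.BirchSwinnertonDyer.BirchSwinnertonDyer.Theorems.SchneiderWeaken

end
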